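import Summits.BirchSwinnertonDyer.Rank1Residual.F1Sign2.KuriharaLevelVanishingAtTwo
import Literature.NumberTheory.EllipticCurves.MazurRubin2010.TwistSelmerRankControl
import Literature.NumberTheory.EllipticCurves.BSDRootNumberSmallConductorProofs
import Literature.NumberTheory.EllipticCurves.KuriharaNumberParityProofs
import Literature.NumberTheory.EllipticCurves.PAdicLFunctionIntegralityAtTwoProofs
import HarnessLib

/-!
# Glue: the two first-layer laws decide the `2`-part of BSD in rank one (cell bsd-f1-sign2, seat -es; MEMO-es §11.3)

`param_eq_of_two_laws` (two laws of shape (a)+(b) over one index set force equal parameters — the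
minimum-exponent argument), `sha_two_val_eq_of_firstLayerLaws : FirstLayerLawAtTwo → AnalyticFirstLayerLawAtTwo →
… → padicValNat 2 #Ш[2^∞] = (padicValRat 2 q).toNat` and
`bsdp_two_of_firstLayerLaws : rank_eq_analyticRank_of_analyticRank_le_one → FirstLayerLawAtTwo →
AnalyticFirstLayerLawAtTwo → (Kim class, r_an = 1, shaAn W = q ≠ 0, 0 ≤ padicValRat 2 q) → BSDp W 2` — the use of
K2-F on the leaf `RankOneAtTwo` (stmt-BirchSwinnertonDyer-19099) for the Kim class {odd torsion, odd Tamagawa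
product, `ρ_{E,2^∞}` onto}; the Gross–Zagier–Kolyvagin input enters as the tree's NAMED FACT (hypothesis), the
`2`-integrality of `#Ш_an` in rank one as an explicit hypothesis.

TYPER FILING (seat `bsd-f1-sign2-ty`, -es landing kit part 4/4, INBOX 2026-08-27T18:53:21Z): `HOME/data-es/landing/FirstLayerLawAtTwoGlue.lean`
sha16 d07410cbcba70282 (generated by `split.py` from `SketchG6.lean` d35efc04968d755c; joint farm check `Joint.lean` d1eaf26b918c249a rc 0, 0 warnings,
0 sorries, standard axioms), re-filed VERBATIM. REF1-AUDIT §19 verdicts (prop33_tau_ratR FAITHFUL-ASSEMBLY = §14 C′; K2-F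
`FirstLayerLawAtTwo` SURVIVES crux-grade OPEN; K2-F_an support) TRANSFER to this kit decl-for-decl (REF1 g3 INBOX 19:02:06Z, 31/31
bodies equal); K2-V/K2-P: REF1 §14 (G3 text; the G6 `LevelVanishingAtTwo` is the finer (W, ℓ, k, ψ) text whose conductor-level
case is PROVED unconditionally in part 3). REF2 v8/v9: K2-V IN-PRINT-ASSEMBLY support, K2-F OPEN-IN-PRINT (Kim 2022 p ≥ 5
template; beyond-print if proved: YES). Nothing asserted beyond the kernel-checked theorems; no named fact; PARTITION: none moved. -/

set_option autoImplicit false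

noncomputable section

open scoped Classical MatrixGroups ModularForm

open CongruenceSubgroup WeierstrassCurve Literature.NumberTheory.EllipticCurves
  Literature.NumberTheory.EllipticCurves.ModularForms NumberField

namespace Summit.BirchSwinnertonDyer.Rank1Residual.F1Sign2

/-! ## Glue: K2-F ∧ K2-F_an decide the `2`-part of BSD in rank one -/

section Glue

/-- The minimum-exponent argument in the abstract: two "first-layer laws" with parameters `s`, `s'`
over the same family of numbers force `s = s'`.  A law with parameter `s` says: (a) every admissible
row `(k, x)` has `x ∈ 2^{min(k, s+1)} ℤ_{(2)}`; (b) some admissible row with `k ≥ s + 2` has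
`x ∉ 2^{s+2} ℤ_{(2)}`. -/
theorem param_eq_of_two_laws {ι : Type*} (adm : ι → Prop) (lev : ι → ℕ) (x : ι → ℚ) (s s' : ℕ)
    (ha : ∀ i, adm i → InTwoPowZLoc (min (lev i) (s + 1)) (x i))
    (hb : ∃ i, adm i ∧ s + 2 ≤ lev i ∧ ¬ InTwoPowZLoc (s + 2) (x i))
    (ha' : ∀ i, adm i → InTwoPowZLoc (min (lev i) (s' + 1)) (x i))
    (hb' : ∃ i, adm i ∧ s' + 2 ≤ lev i ∧ ¬ InTwoPowZLoc (s' + 2) (x i)) : s = s' := by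
  by_contra hne
  rcases Nat.lt_or_gt_of_ne hne with hlt | hgt
  · obtain ⟨i, hi, hk, hnot⟩ := hb
    have h1 : InTwoPowZLoc (min (lev i) (s' + 1)) (x i) := ha' i hi
    have h2 : s + 2 ≤ min (lev i) (s' + 1) := le_min hk (by omega)
    exact hnot (inTwoPowZLoc_mono h2 h1)
  · obtain ⟨i, hi, hk, hnot⟩ := hb'
    have h1 : InTwoPowZLoc (min (lev i) (s + 1)) (x i) := ha i hi
    have h2 : s' + 2 ≤ min (lev i) (s + 1) := le_min hk (by omega)
    exact hnot (inTwoPowZLoc_mono h2 h1)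

/-- **Glue (S): K2-F ∧ K2-F_an ⟹ `v₂ #Ш(E)[2^∞] = v₂ #Ш_an` for the rank-one curves of the Kim class.**
Pure logic from the two laws (the minimum-exponent argument `param_eq_of_two_laws`, run over the
index type of rows `(ℓ, k, [Fact ℓ.Prime], ψ)`). -/
theorem sha_two_val_eq_of_firstLayerLaws (hF : FirstLayerLawAtTwo) (hA : AnalyticFirstLayerLawAtTwo)
    (W : WeierstrassCurve ℚ) [W.IsElliptic] [W.IsGloballyMinimal] {M : ℕ} [NeZero M]
    (f : CuspForm (Gamma0 M) 2) (hf : IsNewformOf W f) (hper : PeriodTransferAtTwo W f)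
    (hsurj : ∀ n : ℕ, W.HasSurjectiveModNGaloisRep ((2 ^ n : ℕ) : ℤ)) (hT : Odd W.torsionOrder)
    (hc : Odd W.tamagawaProduct) (hw : W.rootNumber = -1) (hr : W.mordellWeilRank = 1)
    (hfin : Finite (AddCommGroup.primaryComponent W.sha 2)) (han : W.analyticRank = 1)
    (q : ℚ) (hq : shaAn W = (q : ℂ)) (hq0 : q ≠ 0) :
    padicValNat 2 (Nat.card (AddCommGroup.primaryComponent W.sha 2)) = (padicValRat 2 q).toNat := by
  have HF := hF W f hf hper hsurj hT hc hw hr hfin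
  have HA := hA W f hf hper hsurj hT hc hw han q hq hq0
  simp only at HF HA
  obtain ⟨ha, ℓ, k, hℓ, ψ, hlev, hk, hd1, hd2, hψ, hnot⟩ := HF
  obtain ⟨ha', ℓ', k', hℓ', ψ', hlev', hk', hd1', hd2', hψ', hnot'⟩ := HA
  -- index type of rows `(ℓ, k, [Fact ℓ.Prime], ψ)`
  let ι := (l : ℕ) × (j : ℕ) × (PLift (Fact l.Prime) × ((ZMod l)ˣ →* Multiplicative (ZMod (2 ^ j))))
  let adm : ι → Prop := fun i =>
    haveI : Fact i.1.Prime := i.2.2.1.down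
    IsLevelAtTwo W i.1 ∧ 1 ≤ i.2.1 ∧ (2 ^ i.2.1 : ℤ) ∣ (i.1 : ℤ) - 1 ∧
      (2 ^ i.2.1 : ℤ) ∣ W.frobeniusTrace i.1 - 2 ∧ Function.Surjective i.2.2.2
  let x : ι → ℚ := fun i =>
    haveI : Fact i.1.Prime := i.2.2.1.down
    levelSumTwo f i.1 i.2.1 i.2.2.2
  refine param_eq_of_two_laws adm (fun i => i.2.1) x _ _ ?_ ⟨⟨ℓ, k, ⟨hℓ⟩, ψ⟩, ⟨hlev, (show 1 ≤ k by omega), hd1, hd2, hψ⟩, hk, hnot⟩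
    ?_ ⟨⟨ℓ', k', ⟨hℓ'⟩, ψ'⟩, ⟨hlev', (show 1 ≤ k' by omega), hd1', hd2', hψ'⟩, hk', hnot'⟩
  · rintro ⟨l, j, ⟨hl⟩, φ⟩ ⟨h1, h2, h3, h4, h5⟩
    exact @ha l j hl h1 h2 h3 h4 φ h5
  · rintro ⟨l, j, ⟨hl⟩, φ⟩ ⟨h1, h2, h3, h4, h5⟩
    exact @ha' l j hl h1 h2 h3 h4 φ h5

/-- **Route use (glue to the leaf `RankOneAtTwo` = stmt-19099 on the Kim class): GZK ∧ K2-F ∧ K2-F_an ∧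
(`Ш_an` is `2`-integral) ⟹ `BSDp W 2`.**  `hGZK` is the tree's named Gross–Zagier–Kolyvagin fact
(`rank = r_an` and `Ш` finite for `r_an ≤ 1`); `hint : 0 ≤ v₂(q)` is the (printed for optimal curves
under mild hypotheses, here explicit) `2`-integrality of `#Ш_an` in rank one. -/
theorem bsdp_two_of_firstLayerLaws
    (hGZK : rank_eq_analyticRank_of_analyticRank_le_one)
    (hF : FirstLayerLawAtTwo) (hA : AnalyticFirstLayerLawAtTwo)
    (W : WeierstrassCurve ℚ) [W.IsElliptic] [W.IsGloballyMinimal] {M : ℕ} [NeZero M]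
    (f : CuspForm (Gamma0 M) 2) (hf : IsNewformOf W f) (hper : PeriodTransferAtTwo W f)
    (hsurj : ∀ n : ℕ, W.HasSurjectiveModNGaloisRep ((2 ^ n : ℕ) : ℤ)) (hT : Odd W.torsionOrder)
    (hc : Odd W.tamagawaProduct) (hw : W.rootNumber = -1) (han : W.analyticRank = 1)
    (q : ℚ) (hq : shaAn W = (q : ℂ)) (hq0 : q ≠ 0) (hint : 0 ≤ padicValRat 2 q) :
    BSDp W 2 := by
  obtain ⟨hrk, hshafin⟩ := hGZK W (by omega)
  have hr : W.mordellWeilRank = 1 := by omega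
  have hfin : Finite (AddCommGroup.primaryComponent W.sha 2) := inferInstance
  have hs := sha_two_val_eq_of_firstLayerLaws hF hA W f hf hper hsurj hT hc hw hr hfin han q hq hq0
  refine ⟨hrk, hfin, q, hq, ?_⟩
  rw [hs, Int.toNat_of_nonneg hint]

end Glue

end Summit.BirchSwinnertonDyer.Rank1Residual.F1Sign2
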